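import Mathlib
import HarnessLib

/-!
# Crux `NNMonotoneHard` (stmt-ValiantsHypothesis-11617): the padded word `U^L · v · D^L`

The one object posited by line `thick-queue` of `Cruxes/NNMonotoneHard/PROOF-PLAN.md` (§1, the
measure): a middle word `v : Fin N → Bool` (`true` = opener) is padded by `L` openers in front and
`L` closers at the end, `padWord L N v : Fin (L + N + L) → Bool`.  The thick-queue measure on
nest-free perfect matchings of `[2n]`, `2n = L + N + L`, is the law of the FIFO pairing
(`Literature.Computability.AlgebraicComplexity.fifo`) of `padWord L N v` for `v` uniform among the
words making it a ballot word.  Only the definition and its three defining value lemmas are here;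
everything else is proved in the `FifoMatchingNNMonotoneHard*` theorem files.
-/

-- Sub = Summit single-conjunct layout: the duplicated namespace component is mandated by the tree.
set_option linter.dupNamespace false

namespace Summit.ValiantsHypothesis.ValiantsHypothesis.Theorems.FifoMatching.NNMonotoneHard

/-- **The padded word `U^L · v · D^L`**: `L` openers, then the middle word `v` of length `N`, then
`L` closers. [folklore] -/
def padWord (L N : ℕ) (v : Fin N → Bool) : Fin (L + N + L) → Bool :=
  fun i => if (i : ℕ) < L then true
    else if h : (i : ℕ) - L < N then v ⟨(i : ℕ) - L, h⟩ else false

variable {L N : ℕ} (v : Fin N → Bool)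

/-- The first `L` letters of the padded word are openers. [folklore] -/
theorem padWord_apply_of_lt {i : Fin (L + N + L)} (hi : (i : ℕ) < L) : padWord L N v i = true := by
  unfold padWord; rw [if_pos hi]

/-- The middle letters of the padded word are the letters of `v`. [folklore] -/
theorem padWord_apply_mid (p : Fin N) :
    padWord L N v ⟨L + p, by omega⟩ = v p := by
  unfold padWord
  rw [if_neg (by simp), dif_pos (by simp)]
  congr 1
  ext; simp

/-- The last `L` letters of the padded word are closers. [folklore] -/
theorem padWord_apply_of_ge {i : Fin (L + N + L)} (hi : L + N ≤ (i : ℕ)) :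
    padWord L N v i = false := by
  unfold padWord; rw [if_neg (by omega), dif_neg (by omega)]

end Summit.ValiantsHypothesis.ValiantsHypothesis.Theorems.FifoMatching.NNMonotoneHard
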